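import Mathlib

/-!
# Automorphisms of `G × ℤ` for a perfect group `G`

Solo unit `solo-SmoothPoincare4-informed`, session 9: the algebraic first step of the
"no symmetric trivialisation" theorem for the Miyazawa–Hughes–Kim–Miller homotopy
4-spheres `Σ₂(S⁴, τ^m ρ^n K(2,q,r))` (HOME `paper/miyazawa-spheres.md`, Thm 9.5, Step 1).
There `G = π₁(Σ(2,q,r))` is perfect and `π₁(Σ(2,q,r) × S¹) = G × ℤ`; Step 1 says that every
automorphism of `G × ℤ` preserves the factor `G × {0}`, sends the generator of `ℤ` to
`(z, ±1)` with `z` central, and hence is a "shear" composed with an automorphism of `G`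
and possibly the inversion of `ℤ`.  This file proves exactly these three facts for an
arbitrary perfect group `G` (written multiplicatively, `ℤ` as `Multiplicative ℤ`).
-/

namespace Summit.SmoothPoincare4.SmoothPoincare4.Theorems
namespace PerfectProd

open Subgroup Multiplicative

variable {G : Type*} [Group G]

/-- The commutator subgroup of `G × A`, `A` commutative, is `(commutator G) × 1`. -/
theorem commutator_prod_of_comm (A : Type*) [CommGroup A] :
    commutator (G × A) = (commutator G).prod ⊥ := by
  rw [commutator_def, commutator_def, ← Subgroup.top_prod_top, Subgroup.commutator_prod_prod]
  congr 1
  rw [Subgroup.commutator_eq_bot_iff_le_centralizer]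
  intro x _
  rw [Subgroup.mem_centralizer_iff]
  intro y _
  exact mul_comm y x

variable (hG : commutator G = ⊤)
include hG

/-- For `G` perfect, every automorphism of `G × ℤ` maps the factor `G × 1` into itself. -/
theorem snd_mulEquiv_apply_inl_eq_one (α : (G × Multiplicative ℤ) ≃* (G × Multiplicative ℤ))
    (g : G) : (α (g, 1)).2 = 1 := by
  have hmem : ((g, 1) : G × Multiplicative ℤ) ∈ commutator (G × Multiplicative ℤ) := by
    rw [commutator_prod_of_comm, Subgroup.mem_prod, hG]
    exact ⟨Subgroup.mem_top g, Subgroup.mem_bot.mpr rfl⟩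
  have hchar : (commutator (G × Multiplicative ℤ)).map α.toMonoidHom =
      commutator (G × Multiplicative ℤ) :=
    (Subgroup.characteristic_iff_map_eq.mp inferInstance) α
  have h2 : α (g, 1) ∈ commutator (G × Multiplicative ℤ) := by
    rw [← hchar]
    exact Subgroup.mem_map_of_mem α.toMonoidHom hmem
  rw [commutator_prod_of_comm, Subgroup.mem_prod] at h2
  exact Subgroup.mem_bot.mp h2.2

/-- For `G` perfect, every automorphism of `G × ℤ` maps `G × 1` ONTO `G × 1`. -/
theorem exists_inl_mulEquiv_apply_eq (α : (G × Multiplicative ℤ) ≃* (G × Multiplicative ℤ))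
    (g : G) : ∃ x : G, α (x, 1) = (g, 1) := by
  have hchar : (commutator (G × Multiplicative ℤ)).map α.toMonoidHom =
      commutator (G × Multiplicative ℤ) :=
    (Subgroup.characteristic_iff_map_eq.mp inferInstance) α
  have hmem : ((g, 1) : G × Multiplicative ℤ) ∈
      (commutator (G × Multiplicative ℤ)).map α.toMonoidHom := by
    rw [hchar, commutator_prod_of_comm, Subgroup.mem_prod, hG]
    exact ⟨Subgroup.mem_top g, Subgroup.mem_bot.mpr rfl⟩
  obtain ⟨x, hx, hαx⟩ := Subgroup.mem_map.mp hmem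
  rw [commutator_prod_of_comm, Subgroup.mem_prod] at hx
  have hx2 : x.2 = 1 := Subgroup.mem_bot.mp hx.2
  refine ⟨x.1, ?_⟩
  have : x = (x.1, 1) := Prod.ext rfl hx2
  rw [← this]
  exact hαx

/-- For `G` perfect, every automorphism of `G × ℤ` sends `(1, t)` to an element whose
`G`-coordinate is central. -/
theorem fst_mulEquiv_apply_inr_mem_center (α : (G × Multiplicative ℤ) ≃* (G × Multiplicative ℤ))
    (z : Multiplicative ℤ) : (α (1, z)).1 ∈ Subgroup.center G := by
  rw [Subgroup.mem_center_iff]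
  intro g
  obtain ⟨x, hx⟩ := exists_inl_mulEquiv_apply_eq hG α g
  have hcomm : ((x, 1) : G × Multiplicative ℤ) * (1, z) = (1, z) * (x, 1) := by
    ext <;> simp
  have h := congrArg α hcomm
  rw [map_mul, map_mul, hx] at h
  have h1 := congrArg Prod.fst h
  simpa using h1

/-- For `G` perfect, every automorphism of `G × ℤ` induces `± id` on the `ℤ` factor:
the `ℤ`-coordinate of the image of the generator `(1, 1)` is `1` or `-1`. -/
theorem toAdd_snd_mulEquiv_apply_inr_eq (α : (G × Multiplicative ℤ) ≃* (G × Multiplicative ℤ)) :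
    toAdd (α (1, ofAdd (1 : ℤ))).2 = 1 ∨ toAdd (α (1, ofAdd (1 : ℤ))).2 = -1 := by
  -- the composite `Multiplicative ℤ → G × ℤ → G × ℤ → Multiplicative ℤ`
  set ψ : Multiplicative ℤ →* Multiplicative ℤ :=
    (MonoidHom.snd G (Multiplicative ℤ)).comp (α.toMonoidHom.comp (MonoidHom.inr G (Multiplicative ℤ)))
    with hψ
  have hψ1 : ψ (ofAdd 1) = (α (1, ofAdd (1 : ℤ))).2 := by
    simp [hψ]
  -- surjectivity of `α` gives a preimage of `(1, ofAdd 1)`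
  obtain ⟨y, hy⟩ := α.surjective (1, ofAdd (1 : ℤ))
  have hysplit : y = (y.1, 1) * (1, y.2) := by ext <;> simp
  have hsnd : (α y).2 = (α (1, y.2)).2 := by
    rw [hysplit, map_mul, Prod.snd_mul, snd_mulEquiv_apply_inl_eq_one hG α y.1, one_mul]
    simp
  have hαinr : (α (1, y.2)).2 = ψ y.2 := by simp [hψ]
  -- `ψ y.2 = ψ (ofAdd 1) ^ (toAdd y.2)`
  have hpow : ψ y.2 = ψ (ofAdd 1) ^ (toAdd y.2) := by
    conv_lhs => rw [show y.2 = ofAdd (1 : ℤ) ^ (toAdd y.2) by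
      rw [← ofAdd_zsmul, smul_eq_mul, mul_one, ofAdd_toAdd]]
    exact map_zpow ψ _ _
  have key : ofAdd (1 : ℤ) = (α (1, ofAdd (1 : ℤ))).2 ^ (toAdd y.2) := by
    have := congrArg Prod.snd hy
    rw [hsnd, hαinr, hpow, hψ1] at this
    exact this.symm
  -- pass to `ℤ`
  set k : ℤ := toAdd (α (1, ofAdd (1 : ℤ))).2 with hk
  have hk' : (α (1, ofAdd (1 : ℤ))).2 = ofAdd k := by rw [hk, ofAdd_toAdd]
  rw [hk', ← ofAdd_zsmul, smul_eq_mul] at key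
  have hmul : k * toAdd y.2 = 1 := by
    have := congrArg toAdd key
    simpa [mul_comm] using this.symm
  rcases Int.eq_one_or_neg_one_of_mul_eq_one' hmul with ⟨h, _⟩ | ⟨h, _⟩
  · exact Or.inl h
  · exact Or.inr h

end PerfectProd
end Summit.SmoothPoincare4.SmoothPoincare4.Theorems
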